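import Summits.BirchSwinnertonDyer.Rank1Residual.X10.CasselsTatePairingRecordsMinimality
import HarnessLib

/-!
# CTP-on-Sel³ instrument records, part E: the CM curve `350464h1` — a THEOREM-backed NON-ZERO control ON THE 3Ns PATH (cell `b2b-bsdres`, unit `b2b-bsdres-x10`, gen 15)

HONEST FRAMING (run/shared/lean/b2b/bsd-rank1-residual/, verbatim in every file): the goal of the
cell is to DELETE the COMBINATION-SHAPED residual classes of the Birch–Swinnerton-Dyer formula for
ALL analytic-rank `≤ 1` elliptic curves over `ℚ` — "full BSD formula for every rank `≤ 1` curve in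
class `C`" assembled STRICTLY from published theorems — so that the rank-`≤ 1` remainder becomes
exactly the CONSTRUCTION-SHAPED classes, which are TYPED (missing-input `Prop`s), NOT attempted.
This is not "finishing BSD". Theorems only (no definition, no named fact); NOTHING IS BOOKED here;
no class label changes. Per pair. The curve of this file is a CM curve and lies in NO residual class
of the cell (CM rank `0` is covered in print); it is recorded ONLY as an instrument CONTROL.

**What this file is.** Parts A–D record rank-`0` curves with mod-`3` image `3Ns` and `3 ∣ #Ш_an`
(the fourteen X10b-lane targets, eight further Cremona pairs, four pairs beyond Cremona). On that
code path of the CTP-on-Sel³ instrument no control with a THEOREM as truth value existed: the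
Skinner–Urban hypothesis (ram) fails for every `3Ns` image (X10-AUDIT §20.3). Gen 15 observed that
complex multiplication gives a second published route: for `E/ℚ` with CM by the maximal order of
`K = ℚ(√−2)` (`j = 8000`) or `ℚ(√−11)` (`j = −32768`) the prime `3` splits in `K`, so `E` is good
ordinary at `3` when `3 ∤ N` and `ρ̄_{E,3}(G_ℚ)` lies in the normaliser of a split Cartan subgroup —
the instrument's `3Ns` path — and Rubin's theorem (Invent. Math. 103 (1991), Thm. 12.3: the
cyclotomic main conjecture for CM curves at good ordinary `p > 2`; tree
`Literature.NumberTheory.EllipticCurves.Rubin1991.CyclotomicMainConjectureCM`, named fact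
`thm123_charIdeal_eq_padicLFunction_of_cm` with the rank-`0` consequence `pPartRankZero_of_cm`)
makes `ord₃ #Ш(E/ℚ) = ord₃(L(E,1)·#E(ℚ)_tors² / (Ω_E·∏ c_ℓ))` a published theorem for such curves of
analytic rank `0`. Cremona's table (`N < 5·10⁵`) contains exactly ONE such isogeny class with
`9 ∣ #Ш_an`: `350464h` (`N = 2⁸·37²`, `#E(ℚ)_tors = 2`, `∏ c_ℓ = 4`, exact rank-`0` value
`#Ш_an = 9`), so `ord₃ #Ш(350464h1) = 2` is THEOREM-backed; x10b's two-engine exact `3`-descent gives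
`dim_𝔽₃ Sel^(3) = 2` (kit j135597), hence `Ш[3^∞] = Ш[3] ≅ (ℤ/3)²` and the Cassels–Tate pairing on
`Sel^(3) = Ш[3]` is NON-degenerate — a prediction BY THEOREM that the instrument must return an
alternating NON-ZERO Gram matrix. Route A's chain (kit j135643; stage A4 = gen-15 `bundle_a4v2`,
writer r4.1) returned `G = [[0,1],[2,0]]`, alternating of rank `2`: the control PASSES (document
`HOME/b2b-bsdres-x10/g15/ctp-sel3/cm3ns/certs/ctp_cert_350464h1.json`, sha16 `8e5ffb3951f7c2c8`; a
hub-local forced run of verifier B's reader of record ctpB-0.7.10.1-M2h agrees row for row —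
non-authoritative; B has NOT read it of record). Write-up: `HOME/b2b-bsdres-x10/g15/ctp-sel3/cm3ns/
CM-CONTROLS-3Ns.md`. This file records the curve in the two class-free record shapes of parts A–D so
that the kernel decides its side facts (`Δ ≠ 0`, global minimality by the support-based Kraus
criterion, irreducibility of `E[3]` by a Frobenius witness); the CTP binders displayed are PRECISELY
the content of the document; `hcard` is the two-engine descent line; `hr`/`hv` are Cremona's exact
rank-`0` data. No theorem of this file uses Rubin's theorem — the THEOREM side lives in the cited
Literature module; here it only explains why this record is a CONTROL and not a cell pair.

**Status of the displayed binders.** `hGZK` (published); `hr : r_an = 0` (Cremona: `L(E,1)/Ω` exact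
and non-zero); `hcard : #Sel^(3) = 9` (x10b's two engines, exact, j135597); the PAIRING binders = the
ctp-sel3/1.1 document of j135643 (route A only; verifier B unread of record); `hv : ord₃ #Ш_an = 2`
(Cremona, exact for rank `0`). These theorems book nothing.

References: as in part A — Cassels 1998 §1 [Cassels1998]; Fisher–Newton 2014 Thm. 1.3
[FisherNewton2014]; Miller 2011 Def. 1.1 [Miller2011LMS]; Mazur 1978 Prop. 6.3 (1) [Mazur1978];
Kraus 1989 [Kraus1989]; Silverman AEC VII Rem. 1.1 [SilvermanAEC2009]; K. Rubin, Invent. Math. 103 (1991) 25–68, Thm. 12.3 [Rubin1991]; cell files X10-AUDIT.md §21,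
`HOME/b2b-bsdres-x10/g15/ctp-sel3/cm3ns/`.
-/

set_option autoImplicit false

noncomputable section

open scoped Classical

open WeierstrassCurve Literature.NumberTheory.EllipticCurves
  Literature.NumberTheory.EllipticCurves.Rank1Residual
  Literature.NumberTheory.EllipticCurves.Rank1Residual.Typed
  Literature.NumberTheory.EllipticCurves.Rank1Residual.X11RankOneCertificates
  Summit.BirchSwinnertonDyer.BirchSwinnertonDyer.Rank1Residual.IntModel
  Summit.BirchSwinnertonDyer.BirchSwinnertonDyer.Rank1Residual.X11RankOne
  Summit.BirchSwinnertonDyer.Rank1Residual.X11b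

namespace Summit.BirchSwinnertonDyer.Rank1Residual.X10

/-! ### §1. Frobenius point-count witnesses for irreducibility of `E[3]` (kernel-decided data) -/

/-- `#Ẽ(𝔽_{7}) = 8` (`a_{7} = 0`; `X² + 7` is root-free mod `3`) for Cremona's minimal model `[0, -1, 0, -4563, -103537]` of `350464h1` (kernel count). [folklore] -/
theorem card_t350464h1_7 :
    Nat.card (((⟨0, (-1), 0, (-4563), (-103537)⟩ : WeierstrassCurve ℤ).map (Int.castRingHom (ZMod 7))).toAffine.Point) = 8 := by
  rw [@WeierstrassCurve.natCard_point_eq_one_add_card (ZMod 7) (@ZMod.instField 7 ⟨by norm_num⟩) _ _ _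
    (by decide +kernel), @card_sol_eq_sum_euler (ZMod 7) (@ZMod.instField 7 ⟨by norm_num⟩) _ _
    (by rw [ZMod.ringChar_zmod_n]; decide), ZMod.card]
  decide +kernel

/-! ### §2. The record, in two shapes (class-free consumers `padicValNat_shaOrder_three_eq_two_of_ainvs_of_ctpGram` / `bsdp_three_of_ainvs_of_ctpGram`; minimality and `Δ ≠ 0` kernel-decided per record) -/

/-- **`350464h1` (CM control): the exact `3`-part `ord₃ #Ш(E/ℚ) = 2` (`#Ш[3^∞] = 9`) from the CTP-on-Sel³ certificate shape WITHOUT any analytic `Ш` value** — for this curve the same conclusion is a THEOREM by Rubin 1991 (module docstring): the record is an instrument CONTROL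
(`N = 350464 = 2⁸·37²`: CM by ℤ[√−2] (j = 8000); good ORDINARY at 3 (a₃ = 2); a CONTROL curve, in NO residual class of the cell; Cremona's minimal model `[0, -1, 0, -4563, -103537]` of `350464h1`; `ρ̄_{E,3}` irreducible, NOT surjective, image `3Ns` (CM, `3` split in `ℚ(√−2)`); analytic rank `0` and `#Ш_an = 9`
(`ord₃ = 2`) EXACT from Cremona's rank-`0` table — and `ord₃ #Ш = 2` a THEOREM by Rubin 1991 Thm. 12.3 (see the module docstring); `∏ c_ℓ = 4`, `#E(ℚ)_tors = 2`). Displayed binders: `hGZK`; `r_an = 0` (numerics); `hcard` = the exact two-engine `3`-descent line `dim_𝔽₃ Sel^(3)(E/ℚ) = 2` (x10b `desc3ns` +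
`desc3ns_e2`, kit j135597, bnfcertify = 1, cross-checks true); the pairing binders = the ctp-sel3/1.1 TARGET-shaped document of this curve in
`HOME/b2b-bsdres-x10/g15/ctp-sel3/cm3ns/certs/` (route A's G = `[[0, 1], [2, 0]]` — alternating, rank 2; document `ctp_cert_350464h1.json` sha16 `8e5ffb3951f7c2c8`, kit j135643; forced run of B's 0.7.10.1 reader code agrees row for row, non-authoritative; VERIFIER B UNREAD OF RECORD; outside the R-281(d) exception; nothing is booked on it).
Kernel-decided here: `Δ ≠ 0`; global minimality by x11c's support-based criterion `X11b.isGloballyMinimal_of_krausCriterion_support` (support `[(2, 8, 9), (37, 2, 6)]` =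
(prime, conductor exponent, `v_p(Δ)`));
`E[3]` irreducible (`ℓ = 7`, `#Ẽ(𝔽_{7}) = 8`, `a_{7} = 0`). Per pair; books nothing.
[cite: Miller2011LMS, Def. 1.1] [cite: FisherNewton2014, Thm. 1.3] [cite: Kraus1989, Prop. 2] [cite: Mazur1978, §6 Prop. 6.3 (1) (p. 153)] -/
theorem padicValNat_shaOrder_t350464h1 (hGZK : rank_eq_analyticRank_of_analyticRank_le_one)
    (W : WeierstrassCurve ℚ) (hW : W = ⟨0, (-1), 0, (-4563), (-103537)⟩)
    (hr : W.analyticRank = 0) (hcard : Nat.card (W.selmerGroup (3 : ℤ)) = 9)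
    {Q : Type*} [AddCommGroup Q] (B : W.sha →+ W.sha →+ Q) {x₁ x₂ : W.sha}
    (hx₁ : 3 • x₁ = 0) (hx₂ : 3 • x₂ = 0)
    (h₁₁ : B x₁ x₁ = 0) (h₂₂ : B x₂ x₂ = 0) (h₁₂ : B x₁ x₂ ≠ 0) (h₂₁ : B x₂ x₁ ≠ 0) :
    padicValNat 3 W.shaOrder = 2 := by
  subst hW
  have hE := isElliptic_of_discOf_ne_zero 0 (-1) 0 (-4563) (-103537) (by decide +kernel)
  have hM := X11b.isGloballyMinimal_of_krausCriterion_support 0 (-1) 0 (-4563) (-103537)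
    [(2, 8, 9), (37, 2, 6)] (by decide +kernel) (by decide +kernel) (by decide +kernel)
  haveI : Fact (Nat.Prime 7) := ⟨by norm_num⟩
  exact @padicValNat_shaOrder_three_eq_two_of_ainvs_of_ctpGram hGZK 0 (-1) 0 (-4563) (-103537) _ hE hM
    (@integralModelInt_eq_of_map_eq _ hM _ (map_mk_int _ _ _ _ _)) 7 8 _ (by decide) (by decide +kernel)
    card_t350464h1_7 (by decide +kernel) hr hcard Q _ B x₁ x₂ hx₁ hx₂ h₁₁ h₂₂ h₁₂ h₂₁

/-- **`BSD(E,3)` for `350464h1` (CM control) from the CTP-on-Sel³ certificate shape** — the same binders plus `hv : ord₃ #Ш_an = 2` (Cremona, exact); for this CM curve `BSD(E,3)` is ALSO a theorem in print (Rubin 1991), which is what makes it a control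
(`N = 350464 = 2⁸·37²`: CM by ℤ[√−2] (j = 8000); good ORDINARY at 3 (a₃ = 2); a CONTROL curve, in NO residual class of the cell; Cremona's minimal model `[0, -1, 0, -4563, -103537]` of `350464h1`; `ρ̄_{E,3}` irreducible, NOT surjective, image `3Ns` (CM, `3` split in `ℚ(√−2)`); analytic rank `0` and `#Ш_an = 9`
(`ord₃ = 2`) EXACT from Cremona's rank-`0` table — and `ord₃ #Ш = 2` a THEOREM by Rubin 1991 Thm. 12.3 (see the module docstring); `∏ c_ℓ = 4`, `#E(ℚ)_tors = 2`). Displayed binders: `hGZK`; `r_an = 0` (numerics); `hcard` = the exact two-engine `3`-descent line `dim_𝔽₃ Sel^(3)(E/ℚ) = 2` (x10b `desc3ns` +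
`desc3ns_e2`, kit j135597, bnfcertify = 1, cross-checks true); the pairing binders = the ctp-sel3/1.1 TARGET-shaped document of this curve in
`HOME/b2b-bsdres-x10/g15/ctp-sel3/cm3ns/certs/` (route A's G = `[[0, 1], [2, 0]]` — alternating, rank 2; document `ctp_cert_350464h1.json` sha16 `8e5ffb3951f7c2c8`, kit j135643; forced run of B's 0.7.10.1 reader code agrees row for row, non-authoritative; VERIFIER B UNREAD OF RECORD; outside the R-281(d) exception; nothing is booked on it).
Kernel-decided here: `Δ ≠ 0`; global minimality by x11c's support-based criterion `X11b.isGloballyMinimal_of_krausCriterion_support` (support `[(2, 8, 9), (37, 2, 6)]` =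
(prime, conductor exponent, `v_p(Δ)`));
`E[3]` irreducible (`ℓ = 7`, `#Ẽ(𝔽_{7}) = 8`, `a_{7} = 0`). Per pair; books nothing.
[cite: Miller2011LMS, Def. 1.1] [cite: FisherNewton2014, Thm. 1.3] [cite: Kraus1989, Prop. 2] [cite: Mazur1978, §6 Prop. 6.3 (1) (p. 153)] -/
theorem bsdp_t350464h1 (hGZK : rank_eq_analyticRank_of_analyticRank_le_one)
    (W : WeierstrassCurve ℚ) (hW : W = ⟨0, (-1), 0, (-4563), (-103537)⟩)
    (hr : W.analyticRank = 0) (hcard : Nat.card (W.selmerGroup (3 : ℤ)) = 9)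
    {Q : Type*} [AddCommGroup Q] (B : W.sha →+ W.sha →+ Q) {x₁ x₂ : W.sha}
    (hx₁ : 3 • x₁ = 0) (hx₂ : 3 • x₂ = 0)
    (h₁₁ : B x₁ x₁ = 0) (h₂₂ : B x₂ x₂ = 0) (h₁₂ : B x₁ x₂ ≠ 0) (h₂₁ : B x₂ x₁ ≠ 0)
    {q : ℚ} (hq : shaAn W = (q : ℂ)) (hv : padicValRat 3 q = 2) : BSDp W 3 := by
  subst hW
  have hE := isElliptic_of_discOf_ne_zero 0 (-1) 0 (-4563) (-103537) (by decide +kernel)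
  have hM := X11b.isGloballyMinimal_of_krausCriterion_support 0 (-1) 0 (-4563) (-103537)
    [(2, 8, 9), (37, 2, 6)] (by decide +kernel) (by decide +kernel) (by decide +kernel)
  haveI : Fact (Nat.Prime 7) := ⟨by norm_num⟩
  exact @bsdp_three_of_ainvs_of_ctpGram hGZK 0 (-1) 0 (-4563) (-103537) _ hE hM
    (@integralModelInt_eq_of_map_eq _ hM _ (map_mk_int _ _ _ _ _)) 7 8 _ (by decide) (by decide +kernel)
    card_t350464h1_7 (by decide +kernel) hr hcard Q _ B x₁ x₂ hx₁ hx₂ h₁₁ h₂₂ h₁₂ h₂₁ q hq hv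

end Summit.BirchSwinnertonDyer.Rank1Residual.X10

end
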